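import Summits.QuantumFields.YangMills.Theorems.ParabolicTrajectoryTunedSequenceExistsUniformFreezingMean
import Literature.MathematicalPhysics.QuantumFieldTheory.Sweep1AreaLawProofs

/-!
# `TunedSequenceExists` (stmt-QuantumFields-10524), line `fixed-aspect-window`:
# uniform freezing — the one- and two-point theorems and the consequences for the line

Second half of the volume-uniform freezing helper (seat c4, `--supports stmt-QuantumFields-10524`;
first half: `…UniformFreezingMean`, the Jensen/small-ball bound on the mean action and the
translation-invariance identity).  Proved here, for every compact `G` and continuous unitary `ρ`:

* **`uniform_plaquette_freezing`** — `∀ ε > 0, ∃ β₀, ∀ β ≥ β₀, ∀ S, ∫ (c_N − P(Ũ)) dμ_{β,S} ≤ ε`;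
* **`abs_latticeConnectedCorr_le_deficit`** — `|⟨P ; τ_n P⟩_{β,S}| ≤ 2 c_N ∫ (c_N − P(Ũ)) dμ_{β,S}`
  for EVERY `β, S, n`; **`uniform_twoPoint_freezing[_rep]`** — `sup_{S,n} |⟨P ; τ_n P⟩_{β,S}| → 0`;
* for the line: `volumeMonotone_of_depth_le` ((V) at bounded depth is free, all volumes),
  `volumeMonotone_iff_allDepths` (the depth floor `m₁` of (V) is idle: (V)'s content is the joint
  tail `m → ∞` at `β ≥ β₁`), `exists_uniformCeiling` / `eventually_beta_lt_uniformCeiling` (every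
  tuned witness of the crux has `β_k < b(n_k)` eventually, `b` depending on the depth only — the
  volume-uniform form of Disproof § Ceiling).

What is NOT touched: the canonical normalisation `D⁸` (stubs (U), (A) and the tail of (V)).
References: Osterwalder–Seiler 1978 §2; Chatterjee, J. Funct. Anal. 271 (2016) §7 (small-ball
free-energy bounds, there for `U(N)` on cubes).
-/

noncomputable section

open Filter Topology MeasureTheory
open Literature.MathematicalPhysics.QuantumFieldTheory Literature.MathematicalPhysics.QuantumLattice
open Summit.QuantumFields.YangMills.Theorems.TunedSequenceExists.Negative.Freezing

namespace Summit.QuantumFields.YangMills.Theorems.TunedSequenceExists.UniformFreezing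

section Torus

variable {G : Type} [Group G] [TopologicalSpace G] [IsTopologicalGroup G] [CompactSpace G]
  [MeasurableSpace G] [BorelSpace G] {N : ℕ}

-- `c_N := ∑ i, ∑ j, if i < j then N else 0` (written out, as in `…UniformFreezingMean`).

variable [SecondCountableTopology G]

/-! ## Uniform one-point freezing -/

omit [TopologicalSpace G] [IsTopologicalGroup G] [CompactSpace G] [MeasurableSpace G] [BorelSpace G]
  [SecondCountableTopology G] in
/-- On the good set (all links in `V`) the Wilson action is at most `#plaquettes · η`. [folklore] -/
theorem wilsonAction_le_of_mem_pi {S : ℕ} [NeZero S] (ρ : G →* Matrix (Fin N) (Fin N) ℂ)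
    {V : Set G} {η : ℝ}
    (hV : ∀ a b c d : G, a ∈ V → b ∈ V → c ∈ V → d ∈ V →
      (N : ℝ) - (ρ (a * b * c⁻¹ * d⁻¹)).trace.re < η)
    {U : GaugeConfig 4 S G} (hU : U ∈ Set.univ.pi fun _ : Edge 4 S => V) :
    wilsonAction ρ U ≤ Fintype.card (Plaquette 4 S) * η := by
  unfold wilsonAction
  calc ∑ p : Plaquette 4 S, ((N : ℝ) - (ρ (plaquetteHolonomy U p.1 p.2.1.1 p.2.1.2)).trace.re)
      ≤ ∑ _p : Plaquette 4 S, η := Finset.sum_le_sum fun p _ => by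
        unfold plaquetteHolonomy
        exact (hV _ _ _ _ (hU _ trivial) (hU _ trivial) (hU _ trivial) (hU _ trivial)).le
    _ = Fintype.card (Plaquette 4 S) * η := by
        rw [Finset.sum_const, Finset.card_univ, nsmul_eq_mul]

omit [SecondCountableTopology G] in
/-- The product-Haar measure of the good set. [folklore] -/
theorem measureReal_pi_univ_pi {S : ℕ} [NeZero S] (V : Set G) :
    (Measure.pi fun _ : Edge 4 S => haarProbability G).real (Set.univ.pi fun _ : Edge 4 S => V) =
      (haarProbability G).real V ^ Fintype.card (Edge 4 S) := by
  rw [measureReal_def, Measure.pi_pi, Finset.prod_const, Finset.card_univ, ENNReal.toReal_pow,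
    measureReal_def]

/-- **Uniform one-point freezing.** For every compact group `G`, continuous `ρ` with `Re tr ρ ≤ N`
and `ε > 0` there is `β₀` such that for all `β ≥ β₀` and ALL torus sides `S`,
`∫ (c_N − P(Ũ)) dμ_{β,S} ≤ ε`: the mean corner deficit is small uniformly in the volume.
[folklore] -/
theorem uniform_plaquette_freezing (ρ : G →* Matrix (Fin N) (Fin N) ℂ) (hρ : Continuous ρ)
    (hρN : ∀ g, (ρ g).trace.re ≤ N) {ε : ℝ} (hε : 0 < ε) :
    ∃ β₀ : ℝ, 0 < β₀ ∧ ∀ β : ℝ, β₀ ≤ β → ∀ (S : ℕ) [NeZero S],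
      ∫ U, ((∑ i : Fin 4, ∑ j : Fin 4, if i < j then (N : ℝ) else 0) - actionDensity ρ (torusLift S U)) ∂(wilsonMeasure (d := 4) (L := S) ρ β) ≤ ε := by
  haveI : (haarProbability G).IsOpenPosMeasure := by unfold haarProbability; infer_instance
  haveI : IsProbabilityMeasure (haarProbability G) := isProbabilityMeasure_haarProbability
  -- the neighbourhood
  obtain ⟨V, hVo, h1V, hV⟩ := exists_nhds_plaquetteDeficit_lt ρ hρ (show (0 : ℝ) < ε / 24 by positivity)
  set h : ℝ := (haarProbability G).real V with hh
  have hhpos : 0 < h := by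
    rw [hh, measureReal_def]
    exact ENNReal.toReal_pos (hVo.measure_pos _ ⟨1, h1V⟩).ne' (measure_ne_top _ _)
  have hh1 : h ≤ 1 := by rw [hh]; exact measureReal_le_one
  set Λ : ℝ := Real.log (1 / h) with hΛ
  have hΛ0 : 0 ≤ Λ := Real.log_nonneg (by rw [le_div_iff₀ hhpos]; linarith)
  refine ⟨max 1 (16 * Λ / ε), lt_max_of_lt_left one_pos, fun β hβ S _ => ?_⟩
  have hβ1 : 1 ≤ β := (le_max_left _ _).trans hβ
  have hβ0 : 0 < β := by linarith
  have hβΛ : 16 * Λ ≤ β * ε := by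
    have := (le_max_right _ _).trans hβ
    rwa [div_le_iff₀ hε] at this
  -- the good set
  set Good : Set (GaugeConfig 4 S G) := Set.univ.pi fun _ : Edge 4 S => V with hGood
  have hGm : MeasurableSet Good := MeasurableSet.univ_pi fun _ => hVo.measurableSet
  have hGreal : (Measure.pi fun _ : Edge 4 S => haarProbability G).real Good =
      h ^ Fintype.card (Edge 4 S) := measureReal_pi_univ_pi V
  have hGpos : 0 < (Measure.pi fun _ : Edge 4 S => haarProbability G).real Good := by
    rw [hGreal]; exact pow_pos hhpos _
  have hw : ∀ U ∈ Good, wilsonAction ρ U ≤ Fintype.card (Plaquette 4 S) * (ε / 24) :=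
    fun U hU => wilsonAction_le_of_mem_pi ρ hV hU
  -- the two identities / bounds
  have hle := integral_wilsonAction_le ρ hρ hρN hβ0 hGm hGpos hw
  have heq := integral_wilsonAction_eq_card_mul (S := S) ρ hρ β
  rw [hGreal, heq] at hle
  -- cardinalities
  have hS : (0 : ℝ) < Fintype.card (Site 4 S) := by exact_mod_cast Fintype.card_pos
  have card_planes : Fintype.card {p : Fin 4 × Fin 4 // p.1 < p.2} = 6 := by decide
  have hP : (Fintype.card (Plaquette 4 S) : ℝ) = Fintype.card (Site 4 S) * 6 := by
    rw [show (Fintype.card (Plaquette 4 S) : ℝ) = ((Fintype.card (Site 4 S) *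
        Fintype.card {p : Fin 4 × Fin 4 // p.1 < p.2} : ℕ) : ℝ) by rw [← Fintype.card_prod],
      card_planes]
    push_cast; ring
  have hE : (Fintype.card (Edge 4 S) : ℝ) = Fintype.card (Site 4 S) * 4 := by
    rw [show (Fintype.card (Edge 4 S) : ℝ) = ((Fintype.card (Site 4 S) * Fintype.card (Fin 4) : ℕ) : ℝ)
        by rw [← Fintype.card_prod], Fintype.card_fin]
    push_cast; ring
  have hlog : Real.log (1 / h ^ Fintype.card (Edge 4 S)) = Fintype.card (Edge 4 S) * Λ := by
    rw [hΛ, one_div, ← inv_pow, Real.log_pow, one_div]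
  rw [hlog, hP, hE] at hle
  -- divide by the number of sites
  set I : ℝ := ∫ U, ((∑ i : Fin 4, ∑ j : Fin 4, if i < j then (N : ℝ) else 0) - actionDensity ρ (torusLift S U)) ∂(wilsonMeasure (d := 4) (L := S) ρ β)
  have hI : I ≤ 12 * (ε / 24) + 8 / β * Λ := by
    have h' : Fintype.card (Site 4 S) * I ≤
        Fintype.card (Site 4 S) * (12 * (ε / 24) + 8 / β * Λ) := by
      refine hle.trans (le_of_eq ?_)
      ring
    exact le_of_mul_le_mul_left h' hS
  have h8 : 8 / β * Λ ≤ ε / 2 := by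
    rw [div_mul_eq_mul_div, div_le_iff₀ hβ0]
    linarith
  linarith

/-! ## Uniform two-point freezing -/

-- `abs_re_trace_le_of_mem_unitaryGroup` (`|Re tr M| ≤ N` for unitary `M`) is
-- `Literature.MathematicalPhysics.QuantumFieldTheory.abs_re_trace_le_of_mem_unitaryGroup`.

/-- **The connected curvature correlator is controlled by the mean corner deficit**, for EVERY
coupling, side and separation: `|⟨P ; τ_n P⟩_{β,S}| ≤ 2 c_N · ∫ (c_N − P(Ũ)) dμ_{β,S}` — the
covariance of two `[0, 2c_N]`-valued deficits with equal means (translation invariance).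
[folklore] -/
theorem abs_latticeConnectedCorr_le_deficit {S : ℕ} [NeZero S] (ρ : G →* Matrix (Fin N) (Fin N) ℂ)
    (hρ : Continuous ρ) (hρu : ∀ g, ρ g ∈ Matrix.unitaryGroup (Fin N) ℂ) (β : ℝ) (n : ℕ) :
    |latticeConnectedCorr ρ β S (actionDensity ρ) (actionDensity ρ) n| ≤
      2 * (∑ i : Fin 4, ∑ j : Fin 4, if i < j then (N : ℝ) else 0) * ∫ U, ((∑ i : Fin 4, ∑ j : Fin 4, if i < j then (N : ℝ) else 0) - actionDensity ρ (torusLift S U)) ∂(wilsonMeasure (d := 4) (L := S) ρ β) := by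
  set μ := wilsonMeasure (d := 4) (L := S) ρ β with hμ
  haveI := isProbabilityMeasure_wilsonMeasure (d := 4) (L := S) ρ hρ β
  have hρN : ∀ g, (ρ g).trace.re ≤ N := fun g => (abs_le.1 (abs_re_trace_le_of_mem_unitaryGroup (hρu g))).2
  have hρN' : ∀ g, -(N : ℝ) ≤ (ρ g).trace.re := fun g =>
    (abs_le.1 (abs_re_trace_le_of_mem_unitaryGroup (hρu g))).1
  set c : ℝ := (∑ i : Fin 4, ∑ j : Fin 4, if i < j then (N : ℝ) else 0) with hc
  set v : Literature.Probability.LatticeModels.Site 4 := -Pi.single 0 (n : ℤ) with hv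
  -- the two deficits
  set dX : GaugeConfig 4 S G → ℝ := fun U => c - actionDensity ρ (torusLift S U) with hdX
  set dY : GaugeConfig 4 S G → ℝ := fun U => c - actionDensity ρ (configShift v (torusLift S U))
    with hdY
  have hX0 : ∀ U, 0 ≤ dX U := fun U => cN_sub_actionDensity_nonneg ρ hρN _
  have hY0 : ∀ U, 0 ≤ dY U := fun U => cN_sub_actionDensity_nonneg ρ hρN _
  have hX2 : ∀ U, dX U ≤ 2 * c := fun U => cN_sub_actionDensity_le ρ hρN' _
  have hY2 : ∀ U, dY U ≤ 2 * c := fun U => cN_sub_actionDensity_le ρ hρN' _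
  have hc0 : 0 ≤ c := cN_nonneg N
  -- measurability / integrability
  have hmA : Measurable fun U : GaugeConfig 4 S G => actionDensity ρ (torusLift S U) :=
    (continuous_actionDensity hρ).measurable.comp (measurable_torusLift S)
  have hmB : Measurable fun U : GaugeConfig 4 S G => actionDensity ρ (configShift v (torusLift S U)) :=
    (continuous_actionDensity hρ).measurable.comp ((configShift v).measurable.comp (measurable_torusLift S))
  have hmX : Measurable dX := measurable_const.sub hmA
  have hmY : Measurable dY := measurable_const.sub hmB
  have hbd : ∀ {f : GaugeConfig 4 S G → ℝ}, Measurable f → (∀ U, 0 ≤ f U) → (∀ U, f U ≤ 2 * c) →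
      Integrable f μ := fun hf h0 h2 =>
    Integrable.of_bound hf.aestronglyMeasurable (2 * c) (ae_of_all _ fun U => by
      rw [Real.norm_eq_abs, abs_of_nonneg (h0 U)]; exact h2 U)
  have iX : Integrable dX μ := hbd hmX hX0 hX2
  have iY : Integrable dY μ := hbd hmY hY0 hY2
  have iXY : Integrable (fun U => dX U * dY U) μ := by
    refine Integrable.of_bound (hmX.mul hmY).aestronglyMeasurable (2 * c * (2 * c))
      (ae_of_all _ fun U => ?_)
    rw [Real.norm_eq_abs, abs_of_nonneg (mul_nonneg (hX0 U) (hY0 U))]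
    exact mul_le_mul (hX2 U) (hY2 U) (hY0 U) (by linarith [hX0 U, hX2 U])
  -- equal means (translation invariance)
  have hmean : ∫ U, dY U ∂μ = ∫ U, dX U ∂μ := by
    simp only [hdX, hdY, hμ]
    exact integral_comp_configShift_torusLift (d := 4) (S := S) ρ β
      (fun W : LGConfig 4 G => c - actionDensity ρ W) v
  -- the correlator in terms of the deficits
  have hcorr : latticeConnectedCorr ρ β S (actionDensity ρ) (actionDensity ρ) n =
      ∫ U, dX U * dY U ∂μ - (∫ U, dX U ∂μ) * ∫ U, dY U ∂μ := by
    have hA : ∀ U, actionDensity ρ (torusLift S U) = c - dX U := fun U => by simp [hdX]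
    have hB : ∀ U, actionDensity ρ (configShift v (torusLift S U)) = c - dY U := fun U => by
      simp [hdY]
    unfold latticeConnectedCorr
    simp only [← hv, ← hμ, hA, hB]
    have e1 : ∫ U, (c - dX U) * (c - dY U) ∂μ =
        c * c - c * ∫ U, dY U ∂μ - c * ∫ U, dX U ∂μ + ∫ U, dX U * dY U ∂μ := by
      have hexp : (fun U => (c - dX U) * (c - dY U)) =
          fun U => c * c - c * dY U - c * dX U + dX U * dY U := by funext U; ring
      rw [hexp, integral_add, integral_sub, integral_sub, integral_const, integral_const_mul,
        integral_const_mul]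
      · simp
      · exact (integrable_const _)
      · exact iY.const_mul _
      · exact (integrable_const _).sub (iY.const_mul _)
      · exact iX.const_mul _
      · exact ((integrable_const _).sub (iY.const_mul _)).sub (iX.const_mul _)
      · exact iXY
    have e2 : ∫ U, (c - dX U) ∂μ = c - ∫ U, dX U ∂μ := by
      rw [integral_sub (integrable_const _) iX, integral_const]; simp
    rw [e1, e2, hmean]
    ring
  rw [hcorr, hmean]
  -- bounds
  have hIX0 : 0 ≤ ∫ U, dX U ∂μ := integral_nonneg hX0
  have hIX2 : ∫ U, dX U ∂μ ≤ 2 * c := by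
    calc ∫ U, dX U ∂μ ≤ ∫ _U, 2 * c ∂μ := integral_mono iX (integrable_const _) hX2
      _ = 2 * c := by simp
  have hup : ∫ U, dX U * dY U ∂μ ≤ 2 * c * ∫ U, dX U ∂μ := by
    calc ∫ U, dX U * dY U ∂μ ≤ ∫ U, 2 * c * dY U ∂μ :=
          integral_mono iXY (iY.const_mul _) fun U => mul_le_mul_of_nonneg_right (hX2 U) (hY0 U)
      _ = 2 * c * ∫ U, dX U ∂μ := by rw [integral_const_mul, hmean]
  have hlow : 0 ≤ ∫ U, dX U * dY U ∂μ := integral_nonneg fun U => mul_nonneg (hX0 U) (hY0 U)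
  have hsq : (∫ U, dX U ∂μ) * ∫ U, dX U ∂μ ≤ 2 * c * ∫ U, dX U ∂μ :=
    mul_le_mul_of_nonneg_right hIX2 hIX0
  rw [abs_le]
  constructor <;> nlinarith

/-- **Uniform two-point freezing.** For every compact group `G`, continuous unitary `ρ` and
`ε > 0` there is `β₀` such that `|⟨P ; τ_n P⟩_{β,S}| ≤ ε` for all `β ≥ β₀`, ALL sides `S` and ALL
separations `n` (`P` the corner action density). [folklore] -/
theorem uniform_twoPoint_freezing (ρ : G →* Matrix (Fin N) (Fin N) ℂ) (hρ : Continuous ρ)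
    (hρu : ∀ g, ρ g ∈ Matrix.unitaryGroup (Fin N) ℂ) {ε : ℝ} (hε : 0 < ε) :
    ∃ β₀ : ℝ, 0 < β₀ ∧ ∀ β : ℝ, β₀ ≤ β → ∀ (S : ℕ) [NeZero S] (n : ℕ),
      |latticeConnectedCorr ρ β S (actionDensity ρ) (actionDensity ρ) n| ≤ ε := by
  have hρN : ∀ g, (ρ g).trace.re ≤ N := fun g => (abs_le.1 (abs_re_trace_le_of_mem_unitaryGroup (hρu g))).2
  have hc0 : 0 ≤ (∑ i : Fin 4, ∑ j : Fin 4, if i < j then (N : ℝ) else 0) := cN_nonneg N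
  obtain ⟨β₀, hβ₀, h⟩ := uniform_plaquette_freezing ρ hρ hρN (show 0 < ε / (2 * (∑ i : Fin 4, ∑ j : Fin 4, if i < j then (N : ℝ) else 0) + 1) by positivity)
  refine ⟨β₀, hβ₀, fun β hβ S _ n => ?_⟩
  have h1 := abs_latticeConnectedCorr_le_deficit (S := S) ρ hρ hρu β n
  have h2 := h β hβ S
  calc |latticeConnectedCorr ρ β S (actionDensity ρ) (actionDensity ρ) n|
      ≤ 2 * (∑ i : Fin 4, ∑ j : Fin 4, if i < j then (N : ℝ) else 0) * (ε / (2 * (∑ i : Fin 4, ∑ j : Fin 4, if i < j then (N : ℝ) else 0) + 1)) := h1.trans (mul_le_mul_of_nonneg_left h2 (by positivity))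
    _ ≤ ε := by
        rw [mul_div_assoc']
        rw [div_le_iff₀ (by positivity)]
        nlinarith

end Torus

/-! ## Consequences for the line `fixed-aspect-window` (data `r : LatticeRep G`) -/

section Line

variable {G : Type} [Group G] [TopologicalSpace G] [IsTopologicalGroup G] [CompactSpace G]
  [MeasurableSpace G] [BorelSpace G]

/-- **Uniform two-point freezing for a lattice representation**: `|⟨P ; τ_n P⟩_{β,S}| ≤ ε` for all
`β ≥ β₀(ε)`, all sides `S`, all separations `n` (`P = r.curvature.F`). [folklore] -/
theorem uniform_twoPoint_freezing_rep (r : LatticeRep G) {ε : ℝ} (hε : 0 < ε) :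
    ∃ β₀ : ℝ, 0 < β₀ ∧ ∀ β : ℝ, β₀ ≤ β → ∀ (S : ℕ) [NeZero S] (n : ℕ),
      |latticeConnectedCorr r.ρ β S r.curvature.F r.curvature.F n| ≤ ε := by
  haveI : SecondCountableTopology G := secondCountable_of_latticeRep r
  have hF : r.curvature.F = actionDensity r.ρ := rfl
  rw [hF]
  exact uniform_twoPoint_freezing r.ρ r.continuous r.mem_unitary hε

/-- **A volume-uniform ceiling**: for every prefactor `K` and `θ > 0` there is `b` with
`K · ⟨P ; τ_n P⟩_{β,S} < θ` for all `β ≥ b`, ALL sides `S` and all `n`. [folklore] -/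
theorem exists_uniformCeiling (r : LatticeRep G) (K : ℝ) {θ : ℝ} (hθ : 0 < θ) :
    ∃ b : ℝ, ∀ β : ℝ, b ≤ β → ∀ (S : ℕ) [NeZero S] (n : ℕ),
      K * latticeConnectedCorr r.ρ β S r.curvature.F r.curvature.F n < θ := by
  obtain ⟨β₀, -, h⟩ := uniform_twoPoint_freezing_rep r (show 0 < θ / (2 * (|K| + 1)) by positivity)
  refine ⟨β₀, fun β hβ S _ n => ?_⟩
  have h1 := h β hβ S n
  have hK : 0 ≤ |K| := abs_nonneg K
  calc K * latticeConnectedCorr r.ρ β S r.curvature.F r.curvature.F n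
      ≤ |K| * |latticeConnectedCorr r.ρ β S r.curvature.F r.curvature.F n| := by
        rw [← abs_mul]; exact le_abs_self _
    _ ≤ |K| * (θ / (2 * (|K| + 1))) := mul_le_mul_of_nonneg_left h1 hK
    _ < θ := by
        rw [mul_div_assoc', div_lt_iff₀ (by positivity)]
        nlinarith

/-- **(V) at bounded depth is free.** For every `c > 0`, aspect `L₁ ≥ 2` and depth CAP `m̄` there
is `β₁` such that for all `β ≥ β₁`, all `m ≤ m̄` and ALL half-sides `L` (no lower bound on `L`
needed) the inequality of `VolumeMonotone` holds — both rescaled correlators are within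
`c / (2 log² L₁)` of zero by uniform two-point freezing.  (The `P`-analogue of
`RPDiagonalVariant.volumeMonotoneQ_on_finset`, without reflection positivity.) [folklore] -/
theorem volumeMonotone_of_depth_le (r : LatticeRep G) (M : ℕ) {c : ℝ} (hc : 0 < c) {L₁ : ℕ}
    (hL₁ : 2 ≤ L₁) (mbar : ℕ) :
    ∃ β₁ : ℝ, ∀ (β : ℝ) (m L : ℕ), β₁ ≤ β → m ≤ mbar →
      ((M : ℝ) ^ m) ^ 8 *
          latticeConnectedCorr r.ρ β (2 * (L₁ * M ^ m) + 1) r.curvature.F r.curvature.F (M ^ m) -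
        c / Real.log L₁ ^ 2 ≤
      ((M : ℝ) ^ m) ^ 8 *
          latticeConnectedCorr r.ρ β (2 * L + 1) r.curvature.F r.curvature.F (M ^ m) := by
  have hlog : 0 < Real.log (L₁ : ℝ) := Real.log_pos (by exact_mod_cast hL₁)
  set Kbar : ℝ := ((max (M : ℝ) 1) ^ mbar) ^ 8 with hKbar
  have hK1 : 1 ≤ max (M : ℝ) 1 := le_max_right _ _
  have hKpos : 0 < Kbar := by positivity
  have hpow : ∀ m : ℕ, m ≤ mbar → ((M : ℝ) ^ m) ^ 8 ≤ Kbar := fun m hm => by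
    have h1 : (M : ℝ) ^ m ≤ (max (M : ℝ) 1) ^ m := pow_le_pow_left₀ (Nat.cast_nonneg _) (le_max_left _ _) _
    have h2 : (max (M : ℝ) 1) ^ m ≤ (max (M : ℝ) 1) ^ mbar := pow_le_pow_right₀ hK1 hm
    exact pow_le_pow_left₀ (by positivity) (h1.trans h2) _
  obtain ⟨β₀, -, h⟩ := uniform_twoPoint_freezing_rep r (show 0 < c / (2 * Real.log L₁ ^ 2 * Kbar) by positivity)
  refine ⟨β₀, fun β m L hβ hm => ?_⟩
  have hsmall := h β hβ (2 * (L₁ * M ^ m) + 1) (M ^ m)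
  have hbig := h β hβ (2 * L + 1) (M ^ m)
  have hval : Kbar * (c / (2 * Real.log L₁ ^ 2 * Kbar)) = c / Real.log L₁ ^ 2 / 2 := by
    field_simp
  have hbd : ∀ {x : ℝ}, |x| ≤ c / (2 * Real.log L₁ ^ 2 * Kbar) →
      |((M : ℝ) ^ m) ^ 8 * x| ≤ c / Real.log L₁ ^ 2 / 2 := fun {x} hx => by
    rw [abs_mul, abs_of_nonneg (by positivity : (0 : ℝ) ≤ ((M : ℝ) ^ m) ^ 8), ← hval]
    exact mul_le_mul (hpow m hm) hx (abs_nonneg _) hKpos.le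
  have h1 := abs_le.1 (hbd hsmall)
  have h2 := abs_le.1 (hbd hbig)
  linarith [h1.2, h2.1]

/-- **The depth floor `m₁` of (V) is idle**: `VolumeMonotone r M` is equivalent to its variant
with `∀ m` (the coupling floor `β₁` may still depend on the aspect `L₁`).  So the content of (V) is
exactly the joint regime `m → ∞`, `β ≥ β₁` fixed — in particular it contains no fixed-depth
(Gaussian / freezing) sub-problem. [folklore] -/
theorem volumeMonotone_iff_allDepths (r : LatticeRep G) (M : ℕ) :
    FixedAspectSplit.VolumeMonotone r M ↔
      ∀ c : ℝ, 0 < c → ∃ LV : ℕ, ∀ L₁ : ℕ, LV ≤ L₁ → 2 ≤ L₁ → ∃ β₁ : ℝ,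
        ∀ (β : ℝ) (m L : ℕ), β₁ ≤ β → L₁ * M ^ m ≤ L →
          ((M : ℝ) ^ m) ^ 8 *
              latticeConnectedCorr r.ρ β (2 * (L₁ * M ^ m) + 1) r.curvature.F r.curvature.F (M ^ m) -
            c / Real.log L₁ ^ 2 ≤
          ((M : ℝ) ^ m) ^ 8 *
              latticeConnectedCorr r.ρ β (2 * L + 1) r.curvature.F r.curvature.F (M ^ m) := by
  constructor
  · intro h c hc
    obtain ⟨LV, hLV⟩ := h c hc
    refine ⟨LV, fun L₁ h1 h2 => ?_⟩
    obtain ⟨β₁, m₁, hV⟩ := hLV L₁ h1 h2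
    obtain ⟨β₁', hD⟩ := volumeMonotone_of_depth_le r M hc h2 m₁
    refine ⟨max β₁ β₁', fun β m L hβ hL => ?_⟩
    rcases le_or_gt m₁ m with hm | hm
    · exact hV β m L ((le_max_left _ _).trans hβ) hm hL
    · exact hD β m L ((le_max_right _ _).trans hβ) hm.le
  · intro h c hc
    obtain ⟨LV, hLV⟩ := h c hc
    refine ⟨LV, fun L₁ h1 h2 => ?_⟩
    obtain ⟨β₁, hV⟩ := hLV L₁ h1 h2
    exact ⟨β₁, 0, fun β m L hβ _ hL => hV β m L hβ hL⟩

/-- **Volume-uniform ceiling for tuned witnesses** (strengthens `Disproof § Ceiling`, whose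
ceiling depends on the torus): for every `θ > 0` there is `b : ℕ → ℝ`, depending on `(r, M, θ)`
only, such that along EVERY scheme and depth sequence with `N_1(k) → θ` one has
`β_k < b(n_k)` eventually — whatever the tori `L_k`. [folklore] -/
theorem eventually_beta_lt_uniformCeiling (r : LatticeRep G) (M : ℕ) {θ : ℝ} (hθ : 0 < θ) :
    ∃ b : ℕ → ℝ, ∀ (sch : SpeciesScheme (YMSpecies G)) (n : ℕ → ℕ),
      Tendsto (fun k => ((M : ℝ) ^ n k) ^ 8 *
          latticeConnectedCorr r.ρ (sch.β k) (sch.side k) r.curvature.F r.curvature.F (M ^ n k))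
        atTop (𝓝 θ) →
      ∀ᶠ k in atTop, sch.β k < b (n k) := by
  choose b hb using fun m : ℕ => exists_uniformCeiling r (((M : ℝ) ^ m) ^ 8) (half_pos hθ)
  refine ⟨b, fun sch n hlim => ?_⟩
  have hev : ∀ᶠ k in atTop, θ / 2 < ((M : ℝ) ^ n k) ^ 8 *
      latticeConnectedCorr r.ρ (sch.β k) (sch.side k) r.curvature.F r.curvature.F (M ^ n k) :=
    hlim.eventually (lt_mem_nhds (half_lt_self hθ))
  filter_upwards [hev] with k hk
  by_contra hge
  have h := hb (n k) (sch.β k) (not_lt.1 hge) (sch.side k) (M ^ n k)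
  linarith

end Line

end Summit.QuantumFields.YangMills.Theorems.TunedSequenceExists.UniformFreezing

end
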